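import Literature.AlgebraicGeometry.AbelianSchemes.LevelStructureBaseQuotientDescent
import Literature.AlgebraicGeometry.AbelianSchemes.PolarizationClausesOfThickening
import Literature.AlgebraicGeometry.AbelianSchemes.PolarizationNormalize
import Literature.AlgebraicGeometry.RelativeSpec.GeometricQuotientFreeBaseChange
import Literature.AlgebraicGeometry.Morphisms.RelDimOfEtaleSurjectiveComp
import HarnessLib

/-!
# A polarisation (with its type and symplectic-liftability) descends along a free finite quotient OF THE BASE;
# the polarised triple with level structure descends ([MFK94] Ch. 7 §2 Def. 7.2, §3 Lemma 7.11; SGA 1 VIII 7.8)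

Topic `AlgebraicGeometry/AbelianSchemes`; namespaces `Literature.AlgebraicGeometry.AbelianSchemes.AbelianSchemeOver` (§1–§2)
and `Literature.AlgebraicGeometry.AbelianSchemes.PolarizedAbelianSchemeWithLevel` (§3).  THEOREMS ONLY (no definition,
no named fact, no instance, no notation, no `sorry`; net Literature debt 0).  Cell hodgecm-mathlib (D-0151), F-DAG price
sheet leaf F-10 (10a), fourth instalment, after ★ `AbelianSchemeBaseQuotientDescent` (the abelian scheme and its law
descend), ★ `AbelianSchemeBaseQuotientHomDescent` (homomorphisms and sections descend) and ★
`LevelStructureBaseQuotientDescent` (level structures descend).  The dual pair `DB` of the descended abelian scheme `B`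
is an INPUT (supplied by [MFK94] Cor. 6.8 — the existence of duals, leaf F-3 — or by a Poincaré-sheaf descent); what is
proved here is that the remaining fields `pol`, `hasType`, `symplectic`, `relDim` of ★ `PolarizedAbelianSchemeWithLevel`
descend from `B ×_Q S` to `B`.  EDITION 2 (repair road R2⁺, director s259/s260, cell finding 8aea22b3): the moduli
triple ★ `PolarizedAbelianSchemeWithLevel` now carries the field `hatNormalised` (`(1_X × ε_X̂)^*𝒫 ≅ 𝒪`, the second
normalisation of [MumfordFogartyKirwan1994, Ch. 6 §2 (p. 121)]), so §3 assembles the descended triple over the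
RENORMALISED dual pair ★ `DB.normalize` (★ `DualPair.nonempty_unitHatSlice_iso_normalize`), the polarisation being carried
across by ★ `Polarization.exists_normalize_hasType_isSymplecticLiftable` (same `λ`, type and symplectic-liftable level
structures, ★ `PolarizationNormalize`); §1–§2 are unchanged.  HC_CM is proved only modulo the 7 printed citations until
rung 0 closes; this file discharges none of them (count-neutral capital).

SETTING (§2–§3).  `p : S → Q` an affine geometric quotient by a FREE action `ρ` of the finite group `G` on the base
(ring-form freeness); `B` an abelian scheme over `Q` with a dual pair `DB = (B̂, 𝒫_B)` (total spaces separated), `B ×_Q S`,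
`B̂ ×_Q S` their chosen base changes, on which `G` acts through the second factor (`𝟙 ×_Q ρ(g)`), and `DB.baseChange p`
the base-changed dual pair (★ `AbelianSchemeDualPairBaseChange`).

* §1 (any `g : S' → S` surjective and locally of finite type, e.g. finite étale surjective)
  `Polarization.HasType.of_lam_eq`, `Polarization.HasType.of_baseChange_of_surjective_finiteType`,
  `LevelStructure.IsSymplecticLiftable.of_baseChange_of_surjective_finiteType`,
  `IsOfRelDim.of_baseChange_of_etale_surjective` — the type clause, the symplectic-liftability clause and (for `g`
  étale) the relative dimension DESCEND along `g`: they are read on geometric fibres, and a geometric point of `S`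
  LIFTS to `S'` (★ `Morphisms.exists_comp_eq_of_surjective`).  (The proofs are those of ★ `PolarizationClausesOfThickening`
  — surjective closed immersions, where every point lifts — with the lift replaced by the geometric-point lift.)
* §2 `Polarization.exists_desc_of_free_base_quotient` — a polarisation `pol′` of `B ×_Q S` with respect to
  `DB.baseChange p` whose `λ′` is `G`-EQUIVARIANT descends: there is a polarisation `polB` of `B` with respect to `DB`
  with `(polB.baseChange p).lam = pol′.lam`.  The homomorphism `λ′` descends by ★ `exists_isMonHom_desc_of_free_base_quotient`
  (`B ×_Q S → B` is a geometric quotient of the second-factor action, ★ `isGeometricQuotient_baseChange_of_free`); the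
  ample witness at a geometric point `t = s ≫ p` of `Q` is the witness of `pol′` at `s` transported along
  `(B ×_Q S)_s ≅ B_t` (★ `IsLambdaOfAt.of_baseChange`).
* §3 `PolarizedAbelianSchemeWithLevel.exists_desc_of_free_base_quotient` — THE TRIPLE DESCENDS (edition 2, over the
  renormalised dual pair): for `pol′` as in §2 of type `δ`, a level-`N` structure `φ′` on `B ×_Q S` with `G`-equivariant
  sections, symplectic-liftable for `pol′`, and `B ×_Q S` of relative dimension `g`, there are a polarisation `polB` of
  `B` with respect to `DB.normalize` whose base change has the SAME `λ′` (`(polB.baseChange p).lam = pol′.lam`), `ψ` with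
  `ψ ×_Q S = φ′`, and the clauses over `Q`, such that the triple `(B ×_Q S, DB.normalize ×_Q S, polB ×_Q S, φ′)` over `S`
  IS THE BASE CHANGE of the bi-normalised triple `(B, DB.normalize, polB, ψ)` over `Q` in the sense of ★
  `PolarizedAbelianSchemeWithLevel.IsBaseChangeVia` along `p` (via the two first projections).

Mathlib searched (pin): `AlgebraicGeometry.SmoothOfRelativeDimension` (`smoothOfRelativeDimension_comp`, `Etale`
instances), `MorphismProperty.pullback_fst`, `Over.pullback_map_left` (all used); no quotients of schemes by finite
groups and no dual abelian schemes in Mathlib.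

## References
* D. Mumford, J. Fogarty, F. Kirwan, *Geometric Invariant Theory*, 3rd ed. (1994), Ch. 6 §2 Definitions 6.2–6.3
  (p. 120); Ch. 7 §2 Definition 7.2 (p. 129), remark after Theorem 7.9 (p. 139); §3 Lemma 7.11 (p. 140); App. 7A
  (pp. 234–235). [MumfordFogartyKirwan1994]
* A. Grothendieck, *SGA 1*, Exp. VIII Cor. 7.8; Exp. V Prop. 2.6, Déf. 2.7. [SGA1]
* K.-W. Lan, *Arithmetic compactifications of PEL-type Shimura varieties* (2013), §1.3.6 Lemma 1.3.6.6, Cor. 1.3.6.7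
  (pp. 81–82); Rem. 1.4.1.9 (p. 90). [Lan2013PELCompactifications]
-/

noncomputable section

universe u

open CategoryTheory Limits AlgebraicGeometry MonoidalCategory CartesianMonoidalCategory MonObj

namespace Literature.AlgebraicGeometry.AbelianSchemes.AbelianSchemeOver

open Literature.AlgebraicGeometry.RelativeSpec Literature.AlgebraicGeometry.RelativeSpec.ActionOver
  Literature.AlgebraicGeometry.AbelianVarieties Literature.AlgebraicGeometry.Motives

set_option backward.isDefEq.respectTransparency false

/-! ### §1 The type, the symplectic-liftability clause and the relative dimension descend along a surjective base map -/

section Surjective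

variable {S' S : Scheme.{u}} (A : AbelianSchemeOver S) (g : S' ⟶ S) [Surjective g] [LocallyOfFiniteType g]

/-- **The type clause depends on the polarisation only through `λ`**: two polarisations with the same `λ` have the same
types (`HasType` reads the kernel of `λ̄` on geometric points). [cite: MumfordFogartyKirwan1994, App. 7A (pp. 234–235)] -/
theorem Polarization.HasType.of_lam_eq {D : A.DualPair} {pol₁ pol₂ : A.Polarization D} (h : pol₁.lam = pol₂.lam)
    {n : ℕ} {δ : Fin n → ℕ} (h₁ : pol₁.HasType δ) : pol₂.HasType δ := by
  obtain ⟨lam₁, _, _⟩ := pol₁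
  obtain ⟨lam₂, _, _⟩ := pol₂
  cases h
  exact h₁

omit [Surjective g] [LocallyOfFiniteType g] in
/-- Two polarisations with the same `λ` are equal (the other fields are propositions).
[cite: MumfordFogartyKirwan1994, Ch. 6 §2 Definition 6.3 (p. 120)] -/
theorem Polarization.eq_of_lam_eq {D : A.DualPair} {pol₁ pol₂ : A.Polarization D} (h : pol₁.lam = pol₂.lam) :
    pol₁ = pol₂ := by
  obtain ⟨lam₁, _, _⟩ := pol₁
  obtain ⟨lam₂, _, _⟩ := pol₂
  cases h
  rfl

omit [Surjective g] [LocallyOfFiniteType g] in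
/-- Two level structures with the same sections are equal (the other fields are propositions).
[cite: MumfordFogartyKirwan1994, Ch. 7 §2 Definition 7.1 (p. 129)] -/
theorem LevelStructure.eq_of_σ_eq {g₀ n : ℕ} {φ₁ φ₂ : A.LevelStructure g₀ n} (h : φ₁.σ = φ₂.σ) : φ₁ = φ₂ := by
  obtain ⟨σ₁, _, _, _⟩ := φ₁
  obtain ⟨σ₂, _, _, _⟩ := φ₂
  cases h
  rfl

/-- **THE TYPE CLAUSE DESCENDS ALONG A SURJECTIVE BASE MAP LOCALLY OF FINITE TYPE**: if `λ ×_S S'` has type `δ` then so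
has `λ` — a geometric point `s : Spec Ω → S` lifts to `s' : Spec Ω → S'` (★ `Morphisms.exists_comp_eq_of_surjective`), and
the kernel of `λ̄ ×_S S'` at `s'` on `Ω`-points is carried onto the kernel of `λ̄` at `s = s' ≫ g` by the group
isomorphism `(A ×_S S')_{s'}(Ω) ≅ A_s(Ω)` (★ `fibrePointsMulEquiv`, ★ `mem_kerPointsAt_baseChange_iff`).
[cite: MumfordFogartyKirwan1994, App. 7A (pp. 234–235)] [cite: Lan2013PELCompactifications, §1.3.6 Lemma 1.3.6.6 (pp. 81–82)] -/
theorem Polarization.HasType.of_baseChange_of_surjective_finiteType (D : A.DualPair) (pol : A.Polarization D)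
    {n : ℕ} {δ : Fin n → ℕ} (h : (pol.baseChange g).HasType δ) : pol.HasType δ := by
  -- adapted from ★ `PolarizationClausesOfThickening` (`Polarization.HasType.of_baseChange_of_surjective`)
  refine ⟨h.1, fun Ω _ _ s => ?_⟩
  obtain ⟨s₀, rfl⟩ := Literature.AlgebraicGeometry.Morphisms.exists_comp_eq_of_surjective g s
  obtain ⟨φ₀, hinj, hrange⟩ := h.2 Ω s₀
  refine ⟨(A.fibrePointsMulEquiv g s₀).toMonoidHom.comp φ₀, (A.fibrePointsMulEquiv g s₀).injective.comp hinj, ?_⟩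
  ext P
  constructor
  · rintro ⟨x, rfl⟩
    have hx : φ₀ x ∈ (pol.baseChange g).kerPointsAt s₀ := hrange ▸ Set.mem_range_self x
    exact (pol.mem_kerPointsAt_baseChange_iff g s₀ (φ₀ x)).1 hx
  · intro hP
    obtain ⟨P', rfl⟩ := (A.fibrePointsMulEquiv g s₀).surjective P
    have hP' : P' ∈ Set.range φ₀ := by
      rw [hrange]
      exact (pol.mem_kerPointsAt_baseChange_iff g s₀ P').2 hP
    obtain ⟨x, rfl⟩ := hP'
    exact ⟨x, rfl⟩

/-- **THE SYMPLECTIC-LIFTABILITY CLAUSE DESCENDS ALONG A SURJECTIVE BASE MAP LOCALLY OF FINITE TYPE**: if `φ ×_S S'` is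
symplectic-liftable of type `δ` for `λ ×_S S'` then `φ` is for `λ`.  At a geometric point `s = s' ≫ g` with an ample
witness `Θ` of `λ̄ = Λ(𝒪(Θ))`: `e^*Θ` (`e : (A ×_S S')_{s'} ≅ A_s`, ★ `fibreBaseChangeIso`) is an ample witness of
`λ̄ ×_S S'` at `s'` (★ `IsLambdaOfAt.baseChange`); lift there; transport the lift back along `e⁻¹` (★
`SymplecticLift.nonempty_transport`) to a lift for `(e⁻¹)^*e^*Θ ∼ Θ` (★ `SymplecticLift.nonempty_of_linEquiv`).
[cite: Lan2013PELCompactifications, §1.3.6 Lemma 1.3.6.6 and Cor. 1.3.6.7 (pp. 81–82)]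
[cite: MumfordFogartyKirwan1994, Ch. 7 §2 Definition 7.2 (p. 129)] -/
theorem LevelStructure.IsSymplecticLiftable.of_baseChange_of_surjective_finiteType {D : A.DualPair}
    (pol : A.Polarization D) {g₀ N : ℕ} (φ : A.LevelStructure g₀ N) (δ : Fin g₀ → ℕ)
    (h : (φ.baseChange g).IsSymplecticLiftable (pol.baseChange g) δ) : φ.IsSymplecticLiftable pol δ := by
  -- adapted from ★ `PolarizationClausesOfThickening` (`IsSymplecticLiftable.of_baseChange_of_surjective`)
  intro Ω _ _ s Θ hΘ hlam
  obtain ⟨s₀, rfl⟩ := Literature.AlgebraicGeometry.Morphisms.exists_comp_eq_of_surjective g s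
  haveI := A.isIso_toSchemeHom_fibreBaseChangeIso g s₀
  haveI := A.isIso_toSchemeHom_fibreBaseChangeIso_inv g s₀
  haveI hdom := AbelianVariety.isDominant_toSchemeHom_iso_hom (A.fibreBaseChangeIso g s₀).symm
  -- the witness on the `S'`-side
  have hΘ₀ : (A.divisorBaseChange g s₀ Θ).IsAmple := hΘ.pullback _
  have hlam₀ : (A.baseChange g).IsLambdaOfAt s₀ (D.baseChange g) (pol.baseChange g).lam (A.divisorBaseChange g s₀ Θ) :=
    IsLambdaOfAt.baseChange A g D s₀ pol.lam Θ hlam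
  obtain ⟨Λ₀⟩ := h Ω s₀ _ hΘ₀ hlam₀
  -- transport back along `e⁻¹`
  have he : ∀ j : Fin g₀ ⊕ Fin g₀,
      AlgPoints.map (A.fibreBaseChangeIso g s₀).symm.hom.hom.hom.hom (A.restrictPt (s₀ ≫ g) (φ.σ j)) =
        (A.baseChange g).restrictPt s₀ ((φ.baseChange g).σ j) := fun j => by
    rw [← LevelStructure.map_fibreBaseChangeIso_restrictPt_baseChange_σ A g φ s₀ j]
    exact (A.fibrePointsMulEquiv g s₀).symm_apply_apply _
  obtain ⟨Λ⟩ := Λ₀.nonempty_transport (A.fibreBaseChangeIso g s₀).symm he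
  -- `(e⁻¹)^* e^* Θ` is the same divisor as `Θ`
  have hsame : ((A.divisorBaseChange g s₀ Θ).pullback
      (AbelianVariety.Hom.toSchemeHom (A.fibreBaseChangeIso g s₀).symm.hom)).SameDivisor Θ :=
    ((Θ.pullback_pullback_sameDivisor _ _).trans
      (Θ.pullback_congr_sameDivisor (A.toSchemeHom_fibreBaseChangeIso_inv_comp_hom g s₀))).trans
      Θ.pullback_id_sameDivisor
  exact Λ.nonempty_of_linEquiv hsame.linEquiv

omit [LocallyOfFiniteType g] in
/-- **THE RELATIVE DIMENSION DESCENDS ALONG AN ÉTALE SURJECTIVE BASE MAP**: if `A ×_S S' → S'` is (smooth) of relative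
dimension `n` and `g` is étale surjective then `A → S` is of relative dimension `n` (`pr₁ : A ×_S S' → A` is étale
surjective and `pr₁ ≫ π = π' ≫ g` has relative dimension `n + 0`; ★ `Morphisms.smoothOfRelativeDimension_of_comp_eq_of_etale`).
[cite: GortzWedhorn2020, Remark 16.54 (p. 539)] [cite: Grothendieck1967, Prop. 17.7.7] -/
theorem IsOfRelDim.of_baseChange_of_etale_surjective [Etale g] {n : ℕ} (h : (A.baseChange g).IsOfRelDim n) :
    A.IsOfRelDim n := by
  haveI : SmoothOfRelativeDimension n (pullback.snd A.X.hom g) := h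
  haveI : Etale (pullback.fst A.X.hom g) := MorphismProperty.pullback_fst _ _ inferInstance
  haveI : Surjective (pullback.fst A.X.hom g) := MorphismProperty.pullback_fst _ _ inferInstance
  haveI : Smooth A.X.hom := A.isSmooth
  have hcomp : SmoothOfRelativeDimension (n + 0) (pullback.snd A.X.hom g ≫ g) := inferInstance
  rw [Nat.add_zero] at hcomp
  exact Literature.AlgebraicGeometry.Morphisms.smoothOfRelativeDimension_of_comp_eq_of_etale (pullback.fst A.X.hom g)
    A.X.hom (pullback.snd A.X.hom g ≫ g) pullback.condition n

end Surjective

/-! ### §2 Polarisations descend along a free finite quotient of the base -/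

section Quotient

variable {S Q : Scheme.{u}} {p : S ⟶ Q} {G : Type u} [Group G] [Fintype G] {ρ : ActionOver p G}
  (hq : ρ.IsGeometricQuotient p) [IsAffineHom p]
  (hfree : ∀ (V : Q.Opens), IsAffineOpen V → ∀ g : G, g ≠ 1 →
    Ideal.span (Set.range fun s : Γ(S, p ⁻¹ᵁ V) ↦ ρ.act g V s - s) = ⊤)
  (B : AbelianSchemeOver Q) (DB : B.DualPair) [DB.hat.X.left.IsSeparated]

include hq hfree in
/-- **THE HOMOMORPHISM OF AN EQUIVARIANT POLARISATION DESCENDS.**  In the SETTING of the module docstring: for a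
polarisation `pol′` of `B ×_Q S` with respect to `DB.baseChange p` whose `λ′ : B ×_Q S → B̂ ×_Q S` satisfies
`(𝟙 ×_Q ρ(g)) ≫ λ′ = λ′ ≫ (𝟙 ×_Q ρ(g))` for all `g`, there is a homomorphism `λ_B : B → B̂` over `Q` with
`λ′ ×_Q ⋯ = λ_B ×_Q S`, i.e. `(Over.pullback p).map λ_B = λ′`. [cite: MumfordFogartyKirwan1994, Ch. 7 §2 Definition 7.2 (p. 129) and §3 Lemma 7.11 (p. 140)]
[cite: SGA1, Exp. VIII Cor. 7.8] -/
theorem Polarization.exists_lam_desc_of_free_base_quotient (pol' : (B.baseChange p).Polarization (DB.baseChange p))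
    (hpol' : ∀ g : G,
      pullback.map B.X.hom p B.X.hom p (𝟙 B.X.left) (ρ.aut g).hom (𝟙 Q)
          (by rw [Category.id_comp, Category.comp_id]) (by rw [ρ.aut_comp, Category.comp_id]) ≫ pol'.lam.left =
        pol'.lam.left ≫ pullback.map DB.hat.X.hom p DB.hat.X.hom p (𝟙 DB.hat.X.left) (ρ.aut g).hom (𝟙 Q)
          (by rw [Category.id_comp, Category.comp_id]) (by rw [ρ.aut_comp, Category.comp_id])) :
    ∃ lamB : B.X ⟶ DB.hat.X, IsMonHom lamB ∧ (Over.pullback p).map lamB = pol'.lam := by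
  -- the actions of `G` on `B ×_Q S` and `B̂ ×_Q S` through the second factor, over `pr₁`
  have h₁ : ∀ (C : AbelianSchemeOver Q) (g : G),
      ((1 : G →* Aut C.X.left) g).hom ≫ C.X.hom = C.X.hom ≫ ((1 : G →* Aut Q) g).hom := fun C g => by
    rw [MonoidHom.one_apply, MonoidHom.one_apply]; exact (Category.id_comp _).trans (Category.comp_id _).symm
  have h₂ : ∀ g : G, (ρ.aut g).hom ≫ p = p ≫ ((1 : G →* Aut Q) g).hom := fun g => by
    rw [MonoidHom.one_apply, ρ.aut_comp]; exact (Category.comp_id _).symm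
  have hr : ∀ (C : AbelianSchemeOver Q) (g : G),
      (ActionOver.pullbackMapHom C.X.hom p 1 ρ.aut 1 (h₁ C) h₂ g).hom ≫ pullback.fst C.X.hom p =
        pullback.fst C.X.hom p := fun C g => by
    rw [ActionOver.pullbackMapHom_hom_fst, MonoidHom.one_apply]; exact Category.comp_id _
  let ρB : ActionOver (pullback.fst B.X.hom p) G := ActionOver.onPullback B.X.hom p 1 ρ.aut 1 (h₁ B) h₂ _ (hr B)
  let ρBh : ActionOver (pullback.fst DB.hat.X.hom p) G :=
    ActionOver.onPullback DB.hat.X.hom p 1 ρ.aut 1 (h₁ DB.hat) h₂ _ (hr DB.hat)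
  have hbc : (B.baseChange p).IsBaseChangeVia B p (pullback.fst B.X.hom p) := B.baseChange_isBaseChangeVia p
  have hbch : (DB.hat.baseChange p).IsBaseChangeVia DB.hat p (pullback.fst DB.hat.X.hom p) :=
    DB.hat.baseChange_isBaseChangeVia p
  -- `pr₁ : B ×_Q S → B` is a geometric quotient (base change of the free quotient `p` along `B → Q`)
  have hπ : ρB.IsGeometricQuotient (pullback.fst B.X.hom p) :=
    hq.isGeometricQuotient_baseChange_of_free hfree (IsPullback.of_hasPullback B.X.hom p).flip ρB fun g => by
      change (ActionOver.pullbackMapHom B.X.hom p 1 ρ.aut 1 (h₁ B) h₂ g).hom ≫ _ = _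
      rw [ActionOver.pullbackMapHom_hom_snd]
  -- descend `λ′`
  haveI := pol'.isMonHom
  obtain ⟨lamB, hmon, hsq⟩ := exists_isMonHom_desc_of_free_base_quotient hq hfree hbc hbch hπ ρBh pol'.lam
    fun g => hpol' g
  refine ⟨lamB, hmon, ?_⟩
  have hleft : ((Over.pullback p).map lamB).left = pol'.lam.left := by
    apply pullback.hom_ext
    · exact (pullback.lift_fst _ _ _).trans hsq.symm
    · exact (pullback.lift_snd _ _ _).trans (Over.w pol'.lam).symm
  exact Over.OverMorphism.ext hleft

include hq hfree in
/-- **AN EQUIVARIANT POLARISATION DESCENDS ALONG A FREE FINITE QUOTIENT OF THE BASE.**  In the SETTING of the module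
docstring: a polarisation `pol′` of `B ×_Q S` with respect to `DB.baseChange p` whose `λ′` is `G`-equivariant is the
base change of a polarisation `polB` of `B` with respect to `DB`: `(polB.baseChange p).lam = pol′.lam` (so
`polB.baseChange p = pol′`, ★ `Polarization.eq_of_lam_eq`).  The homomorphism descends by
`exists_lam_desc_of_free_base_quotient`; at a geometric point `t` of `Q`, lifted to `s : Spec Ω → S` (★
`Morphisms.exists_comp_eq_of_surjective`, `p` finite étale surjective), the ample witness `Θ′` of `λ̄′ = Λ(𝒪(Θ′))` at `s`
transports along `(B ×_Q S)_s ≅ B_t` to an ample witness for `λ̄_B` at `t` (★ `IsLambdaOfAt.of_baseChange`).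
[cite: MumfordFogartyKirwan1994, Ch. 6 §2 Definition 6.3 (p. 120), Ch. 7 §2 Definition 7.2 (p. 129) and §3 Lemma 7.11 (p. 140)]
[cite: SGA1, Exp. VIII Cor. 7.8] -/
theorem Polarization.exists_desc_of_free_base_quotient (pol' : (B.baseChange p).Polarization (DB.baseChange p))
    (hpol' : ∀ g : G,
      pullback.map B.X.hom p B.X.hom p (𝟙 B.X.left) (ρ.aut g).hom (𝟙 Q)
          (by rw [Category.id_comp, Category.comp_id]) (by rw [ρ.aut_comp, Category.comp_id]) ≫ pol'.lam.left =
        pol'.lam.left ≫ pullback.map DB.hat.X.hom p DB.hat.X.hom p (𝟙 DB.hat.X.left) (ρ.aut g).hom (𝟙 Q)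
          (by rw [Category.id_comp, Category.comp_id]) (by rw [ρ.aut_comp, Category.comp_id])) :
    ∃ polB : B.Polarization DB, (polB.baseChange p).lam = pol'.lam := by
  haveI : Surjective p := ⟨hq.surjective⟩
  haveI : Etale p := hq.etale_of_free hfree
  obtain ⟨lamB, hmon, hlam⟩ := Polarization.exists_lam_desc_of_free_base_quotient hq hfree B DB pol' hpol'
  refine ⟨{ lam := lamB, isMonHom := hmon, exists_ample := fun Ω _ _ t => ?_ }, hlam⟩
  obtain ⟨s, rfl⟩ := Literature.AlgebraicGeometry.Morphisms.exists_comp_eq_of_surjective p t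
  obtain ⟨Θ', hΘ', hΛ'⟩ := pol'.exists_ample Ω s
  rw [← hlam] at hΛ'
  haveI := B.isIso_toSchemeHom_fibreBaseChangeIso_inv p s
  exact ⟨_, hΘ'.pullback _, IsLambdaOfAt.of_baseChange B p DB s lamB Θ' hΛ'⟩

include hq hfree in
/-- **… WITH ITS TYPE**: in `exists_desc_of_free_base_quotient`, if `pol′` has type `δ` then so has `polB`
(`HasType.of_baseChange_of_surjective_finiteType` along the finite étale surjection `p`).
[cite: MumfordFogartyKirwan1994, App. 7A (pp. 234–235) and Ch. 7 §3 Lemma 7.11 (p. 140)] -/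
theorem Polarization.exists_desc_of_free_base_quotient_of_hasType
    (pol' : (B.baseChange p).Polarization (DB.baseChange p))
    (hpol' : ∀ g : G,
      pullback.map B.X.hom p B.X.hom p (𝟙 B.X.left) (ρ.aut g).hom (𝟙 Q)
          (by rw [Category.id_comp, Category.comp_id]) (by rw [ρ.aut_comp, Category.comp_id]) ≫ pol'.lam.left =
        pol'.lam.left ≫ pullback.map DB.hat.X.hom p DB.hat.X.hom p (𝟙 DB.hat.X.left) (ρ.aut g).hom (𝟙 Q)
          (by rw [Category.id_comp, Category.comp_id]) (by rw [ρ.aut_comp, Category.comp_id]))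
    {n : ℕ} {δ : Fin n → ℕ} (hT : pol'.HasType δ) :
    ∃ polB : B.Polarization DB, polB.baseChange p = pol' ∧ polB.HasType δ := by
  haveI : Surjective p := ⟨hq.surjective⟩
  haveI : Etale p := hq.etale_of_free hfree
  obtain ⟨polB, hlam⟩ := Polarization.exists_desc_of_free_base_quotient hq hfree B DB pol' hpol'
  have heq : polB.baseChange p = pol' := Polarization.eq_of_lam_eq _ hlam
  exact ⟨polB, heq, Polarization.HasType.of_baseChange_of_surjective_finiteType B p DB polB (heq ▸ hT)⟩

end Quotient

end Literature.AlgebraicGeometry.AbelianSchemes.AbelianSchemeOver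

/-! ### §3 The polarised triple with level structure descends along a free finite quotient of the base -/

namespace Literature.AlgebraicGeometry.AbelianSchemes.PolarizedAbelianSchemeWithLevel

open Literature.AlgebraicGeometry.RelativeSpec Literature.AlgebraicGeometry.RelativeSpec.ActionOver

set_option backward.isDefEq.respectTransparency false

variable {S Q : Scheme.{u}} {p : S ⟶ Q} {G : Type u} [Group G] [Fintype G] {ρ : ActionOver p G}
  (hq : ρ.IsGeometricQuotient p) [IsAffineHom p]
  (hfree : ∀ (V : Q.Opens), IsAffineOpen V → ∀ g : G, g ≠ 1 →
    Ideal.span (Set.range fun s : Γ(S, p ⁻¹ᵁ V) ↦ ρ.act g V s - s) = ⊤)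
  (B : AbelianSchemeOver Q) [B.X.left.IsSeparated] (DB : B.DualPair) [DB.hat.X.left.IsSeparated]
  {g₀ N : ℕ} {δ : Fin g₀ → ℕ}

include hq hfree in
/-- **THE POLARISED TRIPLE WITH LEVEL STRUCTURE DESCENDS ALONG A FREE FINITE QUOTIENT OF THE BASE** ([MFK94] remark after
Thm. 7.9 and the mechanism of Lemma 7.11: `𝒜_{g,δ,n} = 𝒜_{g,δ,nk}/Γ` carries the descended universal family) — EDITION 2,
over the renormalised dual pair ([MFK94] Ch. 6 §2 (p. 121): the Poincaré sheaf normalised along BOTH `ε × 1` and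
`1 × ε̂`, as the field `hatNormalised` of ★ `PolarizedAbelianSchemeWithLevel` now demands).  In the SETTING of the
module docstring, let `B ×_Q S` have relative dimension `g₀`, let `pol′` be a polarisation of `B ×_Q S` with respect to
`DB.baseChange p` of type `δ` with `G`-equivariant `λ′`, and let `φ′` be a level-`N` structure on `B ×_Q S` with
`G`-equivariant sections, symplectic-liftable for `pol′`.  Then `B` has relative dimension `g₀` and there are a
polarisation `polB` of `B` WITH RESPECT TO `DB.normalize` of type `δ` whose base change along `p` has the same
homomorphism as `pol′` (`(polB.baseChange p).lam = pol′.lam`), and a level-`N` structure `ψ` on `B`, symplectic-liftable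
for `polB`, with `ψ ×_Q S = φ′`, such that the bi-normalised triple `(B ×_Q S, DB.normalize ×_Q S, polB ×_Q S, φ′)` over
`S` IS THE BASE CHANGE of the bi-normalised triple `(B, DB.normalize, polB, ψ)` over `Q` along `p` in the sense of ★
`IsBaseChangeVia` (via the first projections `B ×_Q S → B`, `B̂ ×_Q S → B̂`): `λ` descends by
`Polarization.exists_desc_of_free_base_quotient` and the clauses by §1 (with respect to the raw `DB`), the descended
polarisation is carried to `DB.normalize` by ★ `Polarization.exists_normalize_hasType_isSymplecticLiftable` (same `λ`,
type, symplectic-liftable level structures), the sections descend by ★ `LevelStructure.exists_desc_of_free_base_quotient`,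
the unit clauses are ★ `DualPair.nonempty_unitHatSlice_iso_normalize` and its base change, and the relation is ★
`baseChange_isBaseChangeVia`.
[cite: MumfordFogartyKirwan1994, Ch. 7 §2 Definition 7.2 (p. 129), remark after Theorem 7.9 (p. 139) and §3 Lemma 7.11 (p. 140)]
[cite: MumfordFogartyKirwan1994, Ch. 6 §2 (p. 121)]
[cite: SGA1, Exp. VIII Cor. 7.8] [cite: Lan2013PELCompactifications, §1.4.1 Remark 1.4.1.9 (p. 90)] -/
theorem exists_desc_of_free_base_quotient (hrel : (B.baseChange p).IsOfRelDim g₀)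
    (pol' : (B.baseChange p).Polarization (DB.baseChange p))
    (hpol' : ∀ g : G,
      pullback.map B.X.hom p B.X.hom p (𝟙 B.X.left) (ρ.aut g).hom (𝟙 Q)
          (by rw [Category.id_comp, Category.comp_id]) (by rw [ρ.aut_comp, Category.comp_id]) ≫ pol'.lam.left =
        pol'.lam.left ≫ pullback.map DB.hat.X.hom p DB.hat.X.hom p (𝟙 DB.hat.X.left) (ρ.aut g).hom (𝟙 Q)
          (by rw [Category.id_comp, Category.comp_id]) (by rw [ρ.aut_comp, Category.comp_id]))
    (hT : pol'.HasType δ) (φ' : (B.baseChange p).LevelStructure g₀ N)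
    (hφ' : ∀ (g : G) (i : Fin g₀ ⊕ Fin g₀), (ρ.aut g).hom ≫ (φ'.σ i).left =
      (φ'.σ i).left ≫ pullback.map B.X.hom p B.X.hom p (𝟙 B.X.left) (ρ.aut g).hom (𝟙 Q)
        (by rw [Category.id_comp, Category.comp_id]) (by rw [ρ.aut_comp, Category.comp_id]))
    (hsymp : φ'.IsSymplecticLiftable pol' δ) :
    ∃ (hrelB : B.IsOfRelDim g₀) (polB : B.Polarization DB.normalize) (hTB : polB.HasType δ)
      (ψ : B.LevelStructure g₀ N) (hsympB : ψ.IsSymplecticLiftable polB δ) (hT' : (polB.baseChange p).HasType δ)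
      (hsymp' : φ'.IsSymplecticLiftable (polB.baseChange p) δ),
      (polB.baseChange p).lam = pol'.lam ∧ ψ.baseChange p = φ' ∧
      (PolarizedAbelianSchemeWithLevel.mk (B.baseChange p) hrel (DB.normalize.baseChange p) (polB.baseChange p) hT' φ'
          hsymp' (DB.normalize.nonempty_unitHatSlice_baseChange_iso DB.nonempty_unitHatSlice_iso_normalize)).IsBaseChangeVia
        (PolarizedAbelianSchemeWithLevel.mk B hrelB DB.normalize polB hTB ψ hsympB DB.nonempty_unitHatSlice_iso_normalize)
        p (pullback.fst B.X.hom p) (pullback.fst DB.hat.X.hom p) := by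
  haveI : Surjective p := ⟨hq.surjective⟩
  haveI : Etale p := hq.etale_of_free hfree
  -- the relative dimension, the polarisation with its type, the level structure (with respect to the raw `DB`)
  have hrelB : B.IsOfRelDim g₀ := AbelianSchemeOver.IsOfRelDim.of_baseChange_of_etale_surjective B p hrel
  obtain ⟨polB₀, hpolB₀, hTB₀⟩ :=
    AbelianSchemeOver.Polarization.exists_desc_of_free_base_quotient_of_hasType hq hfree B DB pol' hpol' hT
  obtain ⟨ψ, hψ⟩ := AbelianSchemeOver.LevelStructure.exists_desc_of_free_base_quotient hq hfree B φ' hφ'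
  have hψeq : ψ.baseChange p = φ' := AbelianSchemeOver.LevelStructure.eq_of_σ_eq _ (funext hψ)
  subst hψeq hpolB₀
  -- the symplectic-liftability clause descends
  have hsympB₀ : ψ.IsSymplecticLiftable polB₀ δ :=
    AbelianSchemeOver.LevelStructure.IsSymplecticLiftable.of_baseChange_of_surjective_finiteType B p polB₀ ψ δ hsymp
  -- renormalise the dual pair over `Q` (★ `PolarizationNormalize`): same `λ`, type, symplectic liftability
  obtain ⟨polB, hlam, hTB, hsympB⟩ := polB₀.exists_normalize_hasType_isSymplecticLiftable hTB₀ ψ hsympB₀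
  -- the bi-normalised descended triple; its base change along `p` is the bi-normalised triple over `S`
  let XQ : PolarizedAbelianSchemeWithLevel g₀ N δ Q :=
    PolarizedAbelianSchemeWithLevel.mk B hrelB DB.normalize polB hTB ψ hsympB DB.nonempty_unitHatSlice_iso_normalize
  refine ⟨hrelB, polB, hTB, ψ, hsympB, (XQ.baseChange p).hasType, (XQ.baseChange p).symplectic, ?_, rfl, ?_⟩
  · change (Over.pullback p).map polB.lam = (Over.pullback p).map polB₀.lam
    rw [hlam]
  · exact XQ.baseChange_isBaseChangeVia p

end Literature.AlgebraicGeometry.AbelianSchemes.PolarizedAbelianSchemeWithLevel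

end
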